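import Summits.QuantumAdvantage.QuantumAdvantage.Theorems.CubicForrelationSignedExactCubicForrelationNotPrBPPStubCubeKernelStatsLemmas2

/-!
# Crux `CubicForrelation.SignedExactCubicForrelationNotPrBPP` (stmt-QuantumAdvantage-13932), line `dual-pingpong-frame`
# (classify-then-count cut): stub `stub_cubeKernelStats` — KERNEL STATISTICS OF THE CUBE TEMPLATE

File 3/3: the registered stub `stub_cubeKernelStats` of the skeleton `Lines/classify_then_count.lean`, verbatim. For
`b(y', y'') = y'·cube^k(y'') ⊕ h(y'')` on `𝔽₂^(6k)` (cube = the `𝔽₈` map `x ↦ x³` blockwise, ANY `h` — the cubic hypothesis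
of the statement is not even used) there is `r ≤ n + 1` with `goodMass b {0} {0} r ≥ 2^(n r)/(n+2)⁸`, i.e. a uniform
element of the candidate space `K(xs) = ⋂_j {v : D_(x_j) D_v b ≡ const}` of `r` uniform probes is a NON-ZERO vector of an
M-subspace of `b` with probability `≥ (n+2)⁻⁸`.

Proof (a cruder but `h`-robust version of the lead's block computation `A_r^k − B_r^k`, KS-cube note §1–§3): take
`r = ⌊log₂ k⌋ + 2` (`2k < 2^r ≤ 4k`, `r ≤ n+1`) and restrict the sum to the event `Ev` of `…Lemmas2.lean` (block `0` of
every probe's `y''`-part is `0`, every other block column has two distinct non-zero entries). There the new-good density is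
`≥ 1/64` (`frac_ge`: `|K(xs)| ≤ 64` by APN + kernel-injectivity of the cube, block by block, junk AND frame directions, `h`
only ever shifting an affine system that is tested at the origin; and `((1,1,1)_0, 0) ∈ K(xs) ∩ (Y' ⊕ 0) ∖ 0`). The event
is a product: `|Ev| ≥ 2^(3k r)·|S1|^(k-1)` (`card_Ev`, an explicit injection) with `|S1| ≥ 8^r − 8·2^r` (`card_S1`: a
column outside `S1` takes values in some `{0, t}`), and Bernoulli (`one_add_mul_le_pow`) with `16(k-1) ≤ 4^r` gives
`|S1|^(k-1) ≥ 8^(r(k-1))/2`; finally `128·8^r ≤ 128·64k³ ≤ (6k+2)⁸` (`arith`). Hence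
`goodMass ≥ |Ev|/64 ≥ 2^(6k r)/(128·8^r) ≥ 2^(n r)/(n+2)⁸`.

* `card_Ev`, `card_S1` — the two counts; `rK_le`, `two_pow_rK_le`, `le_two_pow_rK`, `arith` — the arithmetic
  (`r = Nat.log 2 k + 2`);
* `sum_bound` — the assembled inequality for the template; `stub_cubeKernelStats` — verbatim the registered statement.

References: C. Carlet, *Boolean Functions for Cryptography and Coding Theory*, CUP 2020, Prop. 54 (M-subspaces of the
Maiorana–McFarland class) [Carlet2020]; K. Nyberg, *Differentially uniform mappings for cryptography*, EUROCRYPT '93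
(the cube is APN) [Nyberg1994]; lead c3, `Cruxes/SignedExactCubicForrelationNotPrBPP/Lines/dual_pingpong_frame_KScube.md`
(paper proof for `h = 0`, exact constants). -/

noncomputable section

set_option linter.dupNamespace false -- D-0017: single-problem summit ⇒ `QuantumAdvantage.QuantumAdvantage` by design

namespace Summit.QuantumAdvantage.QuantumAdvantage.Theorems.SignedExactCubicForrelationNotPrBPP

open Finset
open Literature.Computability.Complexity Literature.Computability.QuantumComplexity
open Literature.Computability.QuantumComplexity.BuzetChailloux (bxor zeroVec bxor_self bxor_comm
  bxor_zeroVec zeroVec_bxor bxor_bxor_cancel_left)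
open PolarGeometry (bdot_comm bdot_bxor_left bdot_bxor_right bxor_bxor_assoc bxor_bxor_swap exists_append
  bxor_append xor_frame_eq)

namespace CubeKS

section Template

/-! ### Counting the event -/

/-- **The event is large**: `|Ev| ≥ 2^(3k·r) · |S1|^(k-1)` — the tuples assembled from free `x'`-parts and block
columns (`0` in block `0`, columns of `S1` elsewhere) lie in the event, injectively. [folklore] -/
theorem card_Ev (k' r : ℕ) : 2 ^ ((k' + 1) * 3 * r) * (S1 r).card ^ k' ≤ (Ev k' r).card := by
  let Φ : (Fin r → Fin ((k' + 1) * 3) → Bool) × (Fin k' → Fin r → Fin 3 → Bool) →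
      (Fin r → Fin ((k' + 1) * 3 + (k' + 1) * 3) → Bool) :=
    fun p j => Fin.append (p.1 j) (glue (Fin.cons zeroVec fun q => p.2 q j))
  have hτΦ : ∀ p j, τ (Φ p j) = glue (Fin.cons zeroVec fun q => p.2 q j) := fun p j => τ_append _ _
  have hξΦ : ∀ p j, ξ (Φ p j) = p.1 j := fun p j => ξ_append _ _
  have hcard : ((univ : Finset (Fin r → Fin ((k' + 1) * 3) → Bool)) ×ˢ
      Fintype.piFinset (fun _ : Fin k' => S1 r)).card = 2 ^ ((k' + 1) * 3 * r) * (S1 r).card ^ k' := by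
    rw [Finset.card_product, Finset.card_univ, Fintype.card_piFinset_const, Fintype.card_fun, Fintype.card_fun,
      Fintype.card_bool, Fintype.card_fin, Fintype.card_fin, ← pow_mul]
  rw [← hcard]
  refine Finset.card_le_card_of_injOn Φ (fun p hp => ?_) (fun p₁ _ p₂ _ hp => ?_)
  · have hp2 : ∀ q, p.2 q ∈ S1 r := Fintype.mem_piFinset.1 (Finset.mem_product.1 (Finset.mem_coe.1 hp)).2
    refine Finset.mem_coe.2 (mem_Ev.2 ⟨fun j => ?_, fun q => ?_⟩)
    · rw [hτΦ, blk_glue, Fin.cons_zero]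
    · have e : (fun j => blk (τ (Φ p j)) q.succ) = p.2 q := by
        funext j; rw [hτΦ, blk_glue, Fin.cons_succ]
      rw [e]; exact hp2 q
  · have hj : ∀ j, Φ p₁ j = Φ p₂ j := fun j => congrFun hp j
    refine Prod.ext (funext fun j => ?_) (funext fun q => funext fun j => ?_)
    · rw [← hξΦ p₁ j, ← hξΦ p₂ j, hj j]
    · have h2 := congrArg (fun x => blk (τ x) q.succ) (hj j)
      simpa only [hτΦ, blk_glue, Fin.cons_succ] using h2

/-- **`S1` is almost everything**: `8^r ≤ |S1| + 8·2^r` — a column outside `S1` takes values in `{0, t}` for one `t`.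
[folklore] -/
theorem card_S1 (r : ℕ) : 8 ^ r ≤ (S1 r).card + 8 * 2 ^ r := by
  have htot : (S1 r).card + (univ.filter fun c : Fin r → Fin 3 → Bool =>
      ¬ ∃ j j', c j ≠ zeroVec ∧ c j' ≠ zeroVec ∧ c j ≠ c j').card = 8 ^ r := by
    unfold S1
    rw [Finset.card_filter_add_card_filter_not, Finset.card_univ, Fintype.card_fun, Fintype.card_fin,
      Fintype.card_fun, Fintype.card_bool, Fintype.card_fin]
    norm_num
  have hcompl : (univ.filter fun c : Fin r → Fin 3 → Bool =>
      ¬ ∃ j j', c j ≠ zeroVec ∧ c j' ≠ zeroVec ∧ c j ≠ c j').card ≤ 8 * 2 ^ r := by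
    have hsub : (univ.filter fun c : Fin r → Fin 3 → Bool =>
        ¬ ∃ j j', c j ≠ zeroVec ∧ c j' ≠ zeroVec ∧ c j ≠ c j') ⊆
        (univ : Finset (Fin 3 → Bool)).biUnion fun t =>
          Fintype.piFinset fun _ : Fin r => ({zeroVec, t} : Finset (Fin 3 → Bool)) := by
      intro c hc
      have hc' := (Finset.mem_filter.1 hc).2
      rw [Finset.mem_biUnion]
      by_cases hall : ∀ j, c j = zeroVec
      · exact ⟨zeroVec, Finset.mem_univ _, Fintype.mem_piFinset.2 fun j => by
          rw [hall j]; exact Finset.mem_insert_self _ _⟩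
      · push Not at hall
        obtain ⟨j₀, hj₀⟩ := hall
        refine ⟨c j₀, Finset.mem_univ _, Fintype.mem_piFinset.2 fun j => ?_⟩
        by_cases hj : c j = zeroVec
        · rw [hj]; exact Finset.mem_insert_self _ _
        · have e : c j = c j₀ := by
            by_contra hne; exact hc' ⟨j, j₀, hj, hj₀, hne⟩
          rw [e]; exact Finset.mem_insert_of_mem (Finset.mem_singleton_self _)
    calc _ ≤ _ := Finset.card_le_card hsub
      _ ≤ ∑ t ∈ (univ : Finset (Fin 3 → Bool)),
            (Fintype.piFinset fun _ : Fin r => ({zeroVec, t} : Finset (Fin 3 → Bool))).card :=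
          Finset.card_biUnion_le
      _ ≤ ∑ _t ∈ (univ : Finset (Fin 3 → Bool)), 2 ^ r := Finset.sum_le_sum fun t _ => by
          rw [Fintype.card_piFinset_const]; exact Nat.pow_le_pow_left Finset.card_le_two r
      _ = 8 * 2 ^ r := by rw [Finset.sum_const, smul_eq_mul, card_block]
  omega

/-! ### The number of probes and the real arithmetic -/

/-- The number of probes `r = ⌊log₂ k⌋ + 2` is `≤ n + 1`. [folklore] -/
theorem rK_le (k : ℕ) (hk : 0 < k) : Nat.log 2 k + 2 ≤ k * 3 + k * 3 + 1 := by
  have := Nat.log_lt_self 2 (Nat.pos_iff_ne_zero.1 hk)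
  omega

/-- `2^r ≤ 4k`. [folklore] -/
theorem two_pow_rK_le (k' : ℕ) : (2 : ℝ) ^ (Nat.log 2 (k' + 1) + 2) ≤ 4 * ((k' : ℝ) + 1) := by
  have h1 : 2 ^ Nat.log 2 (k' + 1) ≤ k' + 1 := Nat.pow_log_le_self 2 (Nat.succ_ne_zero k')
  have h2 : 2 ^ (Nat.log 2 (k' + 1) + 2) ≤ 4 * (k' + 1) := by rw [pow_add]; omega
  exact_mod_cast h2

/-- `2k + 2 ≤ 2^r`. [folklore] -/
theorem le_two_pow_rK (k' : ℕ) : 2 * ((k' : ℝ) + 1) + 2 ≤ (2 : ℝ) ^ (Nat.log 2 (k' + 1) + 2) := by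
  have h1 : k' + 1 < 2 ^ (Nat.log 2 (k' + 1) + 1) := Nat.lt_pow_succ_log_self one_lt_two (k' + 1)
  have h2 : 2 * (k' + 1) + 2 ≤ 2 ^ (Nat.log 2 (k' + 1) + 2) := by
    rw [show Nat.log 2 (k' + 1) + 2 = (Nat.log 2 (k' + 1) + 1) + 1 from rfl, pow_succ]; omega
  exact_mod_cast h2

/-- **The real arithmetic**: with `X = 2^r ∈ [2k+2, 4k]` and `N ≥ 8^r − 8·2^r = X³(1 − 8/X²)`,
Bernoulli gives `N^(k-1) ≥ X^(3(k-1))/2`, and `128·X³ ≤ (6k+2)⁸`; together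
`2^(6k r)/(6k+2)⁸ ≤ 2^(3k r)·N^(k-1)/64`. [folklore] -/
theorem arith (k' : ℕ) {N : ℝ} (hN : (8 : ℝ) ^ (Nat.log 2 (k' + 1) + 2) - 8 * 2 ^ (Nat.log 2 (k' + 1) + 2) ≤ N) :
    (2 : ℝ) ^ (((k' + 1) * 3 + (k' + 1) * 3) * (Nat.log 2 (k' + 1) + 2)) /
        ((((k' + 1 : ℕ) : ℝ) * 3 + ((k' + 1 : ℕ) : ℝ) * 3 + 2) ^ 8) ≤
      (2 : ℝ) ^ ((k' + 1) * 3 * (Nat.log 2 (k' + 1) + 2)) * N ^ k' / 64 := by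
  have hX1 := two_pow_rK_le k'
  have hX2 := le_two_pow_rK k'
  set R := (Nat.log 2 (k' + 1) + 2) with hR
  set X : ℝ := (2 : ℝ) ^ R with hX
  have hXpos : 0 < X := by positivity
  have hk0 : (0 : ℝ) ≤ k' := Nat.cast_nonneg _
  have h8 : (8 : ℝ) ^ R = X ^ 3 := by
    rw [hX, ← pow_mul, show (8 : ℝ) = 2 ^ 3 by norm_num, ← pow_mul, mul_comm]
  have e1 : (2 : ℝ) ^ (((k' + 1) * 3 + (k' + 1) * 3) * R) = (X ^ 3) ^ (k' + 1) * (X ^ 3) ^ (k' + 1) := by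
    rw [hX, ← pow_mul, ← pow_mul, ← pow_add]; congr 1; ring
  have e2 : (2 : ℝ) ^ ((k' + 1) * 3 * R) = (X ^ 3) ^ (k' + 1) := by
    rw [hX, ← pow_mul, ← pow_mul]; congr 1; ring
  rw [e1, e2]
  -- Bernoulli: `N^(k-1) ≥ X^(3(k-1)) / 2`
  have hNk : (X ^ 3) ^ k' / 2 ≤ N ^ k' := by
    have hN' : X ^ 3 * (1 + (-8 / X ^ 2)) ≤ N := by
      have e : X ^ 3 * (1 + (-8 / X ^ 2)) = X ^ 3 - 8 * X := by field_simp; ring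
      rw [e, ← h8]; exact hN
    have ha : -8 / X ^ 2 = -(8 / X ^ 2) := neg_div (X ^ 2) 8
    have hXX : (2 * ((k' : ℝ) + 1) + 2) * (2 * ((k' : ℝ) + 1) + 2) ≤ X * X :=
      mul_le_mul hX2 hX2 (by positivity) hXpos.le
    have hbase : 0 ≤ 1 + (-8 / X ^ 2) := by
      have : 8 / X ^ 2 ≤ 1 := by rw [div_le_one (by positivity)]; nlinarith
      rw [ha]; linarith
    have hbern : (1 : ℝ) / 2 ≤ (1 + (-8 / X ^ 2)) ^ k' := by
      have h82 : 8 / X ^ 2 ≤ 2 := by rw [div_le_iff₀ (by positivity)]; nlinarith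
      have hb := one_add_mul_le_pow (show (-2 : ℝ) ≤ -8 / X ^ 2 by rw [ha]; linarith) k'
      have hq : 8 * (k' : ℝ) / X ^ 2 ≤ 1 / 2 := by
        rw [div_le_iff₀ (by positivity)]; nlinarith
      have e : (k' : ℝ) * (-8 / X ^ 2) = -(8 * (k' : ℝ) / X ^ 2) := by ring
      rw [e] at hb
      linarith
    calc (X ^ 3) ^ k' / 2 = (X ^ 3) ^ k' * (1 / 2) := by ring
      _ ≤ (X ^ 3) ^ k' * (1 + (-8 / X ^ 2)) ^ k' := by gcongr
      _ = (X ^ 3 * (1 + (-8 / X ^ 2))) ^ k' := (mul_pow _ _ _).symm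
      _ ≤ N ^ k' := pow_le_pow_left₀ (mul_nonneg (by positivity) hbase) hN' k'
  -- the threshold: `128 X³ ≤ (6k+2)⁸`
  have hD : 128 * X ^ 3 ≤ (((k' + 1 : ℕ) : ℝ) * 3 + ((k' + 1 : ℕ) : ℝ) * 3 + 2) ^ 8 := by
    have h5 : (8 : ℝ) ^ 5 ≤ (6 * k' + 8) ^ 5 := pow_le_pow_left₀ (by norm_num) (by linarith) 5
    have h3 : (4 * (k' : ℝ) + 4) ^ 3 ≤ (6 * k' + 8) ^ 3 := pow_le_pow_left₀ (by positivity) (by linarith) 3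
    have hX3 : X ^ 3 ≤ (4 * (k' : ℝ) + 4) ^ 3 := pow_le_pow_left₀ hXpos.le (by linarith) 3
    have hnn : (0 : ℝ) ≤ (4 * (k' : ℝ) + 4) ^ 3 := by positivity
    calc 128 * X ^ 3 ≤ 128 * (4 * (k' : ℝ) + 4) ^ 3 := by linarith
      _ ≤ 8 ^ 5 * (4 * (k' : ℝ) + 4) ^ 3 := by nlinarith
      _ ≤ (6 * (k' : ℝ) + 8) ^ 5 * (6 * k' + 8) ^ 3 := mul_le_mul h5 h3 hnn (by positivity)
      _ = _ := by rw [← pow_add]; push_cast; ring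
  calc (X ^ 3) ^ (k' + 1) * (X ^ 3) ^ (k' + 1) / _ ≤ (X ^ 3) ^ (k' + 1) * (X ^ 3) ^ (k' + 1) / (128 * X ^ 3) :=
        div_le_div_of_nonneg_left (by positivity) (by positivity) hD
    _ = (X ^ 3) ^ (k' + 1) * ((X ^ 3) ^ k' / 2) / 64 := by rw [pow_succ (X ^ 3) k']; field_simp; ring
    _ ≤ (X ^ 3) ^ (k' + 1) * N ^ k' / 64 := by gcongr

/-! ### Assembly -/

/-- **The cube kernel statistics, assembled**: for the template `b = y'·cube^k(y'') ⊕ h(y'')` (any `h`) and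
`r = ⌊log₂ k⌋ + 2` probes, `goodMass ≥ |Ev|/64 ≥ 2^(3k r)|S1|^(k-1)/64 ≥ 2^(n r)/(n+2)⁸`. [folklore] -/
theorem sum_bound (k : ℕ) (hk : 0 < k) (h : (Fin (k * 3) → Bool) → Bool) (b : (Fin (k * 3 + k * 3) → Bool) → Bool)
    (hb : ∀ y' y'' : Fin (k * 3) → Bool, b (Fin.append y' y'') =
      ((Finset.univ.filter fun i => y' i && cubeP k y'' i).card.bodd ^^ h y'')) :
    (2 : ℝ) ^ ((k * 3 + k * 3) * (Nat.log 2 k + 2)) / ((k * 3 + k * 3 + 2 : ℝ) ^ 8) ≤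
      ∑ xs : Fin (Nat.log 2 k + 2) → (Fin (k * 3 + k * 3) → Bool), ((goodSet b xs).card : ℝ) / ((Kset b xs).card : ℝ) := by
  obtain ⟨k', rfl⟩ : ∃ k', k = k' + 1 := ⟨k - 1, by omega⟩
  have hS1 : (8 : ℝ) ^ (Nat.log 2 (k' + 1) + 2) - 8 * 2 ^ (Nat.log 2 (k' + 1) + 2) ≤ (S1 ((Nat.log 2 (k' + 1) + 2))).card := by
    have h' : ((8 ^ (Nat.log 2 (k' + 1) + 2) : ℕ) : ℝ) ≤ (((S1 ((Nat.log 2 (k' + 1) + 2))).card + 8 * 2 ^ (Nat.log 2 (k' + 1) + 2) : ℕ) : ℝ) := by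
      exact_mod_cast card_S1 ((Nat.log 2 (k' + 1) + 2))
    push_cast at h'
    linarith
  calc _ ≤ (2 : ℝ) ^ ((k' + 1) * 3 * (Nat.log 2 (k' + 1) + 2)) * ((S1 ((Nat.log 2 (k' + 1) + 2))).card : ℝ) ^ k' / 64 := arith k' hS1
    _ ≤ ((Ev k' ((Nat.log 2 (k' + 1) + 2))).card : ℝ) / 64 := by
        gcongr
        exact_mod_cast card_Ev k' ((Nat.log 2 (k' + 1) + 2))
    _ = ∑ _xs ∈ Ev k' ((Nat.log 2 (k' + 1) + 2)), (1 : ℝ) / 64 := by rw [Finset.sum_const, nsmul_eq_mul]; ring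
    _ ≤ ∑ xs ∈ Ev k' ((Nat.log 2 (k' + 1) + 2)), ((goodSet b xs).card : ℝ) / ((Kset b xs).card : ℝ) :=
        Finset.sum_le_sum fun xs hxs => frac_ge hb hxs
    _ ≤ _ := Finset.sum_le_sum_of_subset_of_nonneg (Finset.subset_univ _) fun xs _ _ => by positivity

end Template

end CubeKS

open CubeKS in
/-- **stub `stub_cubeKernelStats` (registered, line `dual-pingpong-frame`, classify-then-count cut): KERNEL
STATISTICS OF THE CUBE TEMPLATE at the pair `(0,0)`.** For `b(y',y'') = y'·cube^k(y'') ⊕ h(y'')` (ANY `h`; the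
cubic hypothesis is not even used) and `r = ⌊log₂ k⌋ + 2 ≤ n + 1` probes, `goodMass b {0} {0} r ≥ 2^(n r)/(n+2)⁸`.
Proof: restrict to the event `Ev` (block `0` of every probe's `y''`-part vanishes, every other block column has two
distinct non-zero entries); there `K(xs)` has at most `64` elements (`card_Kset_le`: APN of the cube and the
injectivity of `t ↦ ker B(t,·)ᵀ` kill every block but `0`, for junk AND frame directions, `h` playing no role) and
contains the non-zero vector `((1,1,1)_0, 0)` of the M-subspace `Y' ⊕ 0` (`goodvec_mem_goodSet`); the event has
density `≥ 8^(-r)(1 − 8·4^(-r))^(k-1) ≥ 8^(-r)/2` (`card_Ev`, `card_S1`, Bernoulli), and `128·8^r ≤ (6k+2)⁸` (`arith`).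
[cite: Carlet2020, Prop. 54] -/
theorem stub_cubeKernelStats :
    ∀ (k : ℕ), 0 < k → ∀ (h : (Fin (k * 3) → Bool) → Bool) (b : (Fin (k * 3 + k * 3) → Bool) → Bool),
      (∀ y' y'' : Fin (k * 3) → Bool, b (Fin.append y' y'') =
        (((Finset.univ.filter fun i => y' i &&
            (fun x : Fin 3 → Bool => (![x 0 ^^ x 1 ^^ x 2 ^^ (x 1 && x 2), (x 0 && x 1) ^^ (x 0 && x 2) ^^ x 1, (x 0 && x 1) ^^ x 2] : Fin 3 → Bool)) (fun s => y'' (finProdFinEquiv ((finProdFinEquiv.symm i).1, s))) (finProdFinEquiv.symm i).2).card).bodd ^^ h y'')) →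
      IsDegLeFun 3 b →
      (∃ r : ℕ, r ≤ k * 3 + k * 3 + 1 ∧ (2 : ℝ) ^ ((k * 3 + k * 3) * r) / ((k * 3 + k * 3 + 2 : ℝ) ^ 8) ≤ (∑ xs : Fin (r) → (Fin (k * 3 + k * 3) → Bool), (((@Finset.filter (Fin (k * 3 + k * 3) → Bool) (fun v => v ∉ ({zeroVec} : Finset (Fin (k * 3 + k * 3) → Bool)) ∧ (∃ V : Finset (Fin (k * 3 + k * 3) → Bool), ((zeroVec ∈ V ∧ ∀ x ∈ V, ∀ y ∈ V, bxor x y ∈ V) ∧ (((V).card : ℝ) ^ 2 = (2 : ℝ) ^ (k * 3 + k * 3)) ∧ ∀ u ∈ V, ∀ v ∈ V, ∀ x, (b x ^^ b (bxor x u) ^^ b (bxor x v) ^^ b (bxor x (bxor u v))) = false) ∧ ({zeroVec} : Finset (Fin (k * 3 + k * 3) → Bool)) ⊆ V ∧ v ∈ V ∧ (∀ s ∈ V, ∀ u ∈ ({zeroVec} : Finset (Fin (k * 3 + k * 3) → Bool)), ((Finset.univ.filter fun i => s i && u i).card).bodd = false))) (Classical.decPred _) (Finset.univ.filter fun (v :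 Fin (k * 3 + k * 3) → Bool) => (∀ s ∈ ({zeroVec} : Finset (Fin (k * 3 + k * 3) → Bool)), ∀ x, (b x ^^ b (bxor x s) ^^ b (bxor x v) ^^ b (bxor x (bxor s v))) = false) ∧ (∀ u ∈ ({zeroVec} : Finset (Fin (k * 3 + k * 3) → Bool)), ((Finset.univ.filter fun i => u i && v i).card).bodd = false) ∧ ∀ j, (∀ y z : Fin (k * 3 + k * 3) → Bool, ((b z ^^ b (bxor z (xs j)) ^^ b (bxor z v) ^^ b (bxor z (bxor (xs j) v))) ^^ (b (bxor z y) ^^ b (bxor (bxor z y) (xs j)) ^^ b (bxor (bxor z y) v) ^^ b (bxor (bxor z y) (bxor (xs j) v)))) = false))).card : ℝ) / (((Finset.univ.filter fun (v : Fin (k * 3 + k * 3) → Bool) => (∀ s ∈ ({zeroVec} : Finset (Fin (k * 3 + k * 3) → Bool)), ∀ x, (b x ^^ b (bxor x s) ^^ b (bxor x v) ^^ b (bxor x (bxor s v))) = false) ∧ (∀ u ∈ ({zeroVec} : Finset (Fin (k * 3 + k * 3) → Bool)), ((Finset.univ.filter fun i => u i && v i).card).bodd = false) ∧ ∀ j,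 (∀ y z : Fin (k * 3 + k * 3) → Bool, ((b z ^^ b (bxor z (xs j)) ^^ b (bxor z v) ^^ b (bxor z (bxor (xs j) v))) ^^ (b (bxor z y) ^^ b (bxor (bxor z y) (xs j)) ^^ b (bxor (bxor z y) v) ^^ b (bxor (bxor z y) (bxor (xs j) v)))) = false))).card : ℝ)))) := by
  intro k hk h b hb _hdeg
  exact ⟨Nat.log 2 k + 2, rK_le k hk, sum_bound k hk h b hb⟩

end Summit.QuantumAdvantage.QuantumAdvantage.Theorems.SignedExactCubicForrelationNotPrBPP
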